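import Mathlib
import Summits.Ventures.HodgeRepro.Tier4.Line1.OrbitLifting

/-!
# LINE L1 (t4-L1-p1) — C7.1 / C7.1∞: the local fibration over the stabiliser, reduced to local transitivity

`Tier4/Line1/LocalFibration.lean`.  Generic over a topological field `F` (Hausdorff, locally compact, σ-compact:
`k_v`, `ℝ`, `ℂ`), `import Mathlib` + `OrbitLifting` only.

p4's C7 census (S12903) states, at every place, `{h ∈ U(W)(k_v) : v₀ h ∈ C} ⊆ Stab(v₀) · K` with `K` compact
(`exists_compact_local_stab_mul_fin` / `…_inf`).  Here the unitary group of a pair `(Bf, Ωf)` of `4 × 4` matrices over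
`F` is the closed subgroup `{g ∈ GL₄(F) : g Ωf = Ωf g ∧ g Bf gᵀ = Bf}`, the sphere of `v₀` is the closed set
`{x : x Bf xᵀ = v₀ Bf v₀ᵀ ∧ (x Ωf) Bf xᵀ = (v₀ Ωf) Bf v₀ᵀ}` (the two `F`-coordinates of `h(x, x) = h(v₀, v₀)`), and
the theorem `exists_compact_stab_mul_of_transitive` proves the fibration statement from ONE hypothesis: the unitary group
is TRANSITIVE on the sphere (local Witt).  Everything else — the group is a locally compact σ-compact topological group,
the sphere is a Baire space, the orbit map is open (Mathlib's open-mapping theorem `isOpenMap_smul_of_sigmaCompact`),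
compacts lift (`OrbitLifting`) — is proved here.  So C7.1 / C7.1∞ ⇐ local Witt at that place, in the kernel.

HC_CM is NOT proved by anyone in this repository.
-/

namespace Summit.Ventures.HodgeRepro.Tier4.Line1

open Topology Matrix

section Generic

variable {F : Type*} [Field F] [TopologicalSpace F] [IsTopologicalRing F] [T2Space F]

/-- `GL₄(F)` is locally compact for `F` locally compact Hausdorff (closed embedding `g ↦ (g, g⁻¹)`). -/
theorem locallyCompactSpace_GL_four [LocallyCompactSpace F] : LocallyCompactSpace (GL (Fin 4) F) := by
  haveI : LocallyCompactSpace (Matrix (Fin 4) (Fin 4) F) :=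
    inferInstanceAs (LocallyCompactSpace (Fin 4 → Fin 4 → F))
  haveI : LocallyCompactSpace (Matrix (Fin 4) (Fin 4) F)ᵐᵒᵖ := inferInstance
  exact (Units.isClosedEmbedding_embedProduct (α := Matrix (Fin 4) (Fin 4) F)).locallyCompactSpace

/-- `GL₄(F)` is σ-compact for `F` σ-compact Hausdorff. -/
theorem sigmaCompactSpace_GL_four [SigmaCompactSpace F] : SigmaCompactSpace (GL (Fin 4) F) := by
  haveI : SigmaCompactSpace (Matrix (Fin 4) (Fin 4) F) :=
    inferInstanceAs (SigmaCompactSpace (Fin 4 → Fin 4 → F))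
  haveI : SigmaCompactSpace (Matrix (Fin 4) (Fin 4) F)ᵐᵒᵖ :=
    (MulOpposite.opHomeomorph (M := Matrix (Fin 4) (Fin 4) F)).symm.isClosedEmbedding.sigmaCompactSpace
  exact (Units.isClosedEmbedding_embedProduct (α := Matrix (Fin 4) (Fin 4) F)).sigmaCompactSpace

/-- **The fibration over the stabiliser for a closed subgroup of `GL₄(F)` transitive on a closed set.**  `U ≤ GL₄(F)`
closed, `S ⊆ F⁴` closed, the orbit `v₀ · U` contained in `S` and `U` transitive on `S`: for every compact `C ⊆ F⁴` there
is a compact set `K` of matrices such that every `h ∈ U` with `v₀ h ∈ C` factors as `h = s * κ` with `s ∈ U` fixing `v₀`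
and `κ ∈ U` with matrix in `K`.  Proof: `U` is a locally compact σ-compact group, `S` a locally compact Hausdorff (hence
Baire) space on which `U` acts continuously and transitively by `g • x = x g⁻¹`; the orbit map is open by the
open-mapping theorem, and `OrbitLifting.exists_compact_stab_mul_of_isOpenMap_right` lifts `C ∩ S`. -/
theorem exists_compact_stab_mul_of_closed_subgroup [LocallyCompactSpace F] [SigmaCompactSpace F]
    (U : Subgroup (GL (Fin 4) F)) (hU : IsClosed (U : Set (GL (Fin 4) F))) (v₀ : Fin 4 → F)
    (S : Set (Fin 4 → F)) (hS : IsClosed S) (horb : ∀ g ∈ U, v₀ ᵥ* (↑g : Matrix (Fin 4) (Fin 4) F) ∈ S)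
    (htrans : ∀ x ∈ S, ∃ g ∈ U, v₀ ᵥ* (↑g : Matrix (Fin 4) (Fin 4) F) = x)
    {C : Set (Fin 4 → F)} (hC : IsCompact C) :
    ∃ K : Set (Matrix (Fin 4) (Fin 4) F), IsCompact K ∧
      ∀ h ∈ U, v₀ ᵥ* (↑h : Matrix (Fin 4) (Fin 4) F) ∈ C →
        ∃ s ∈ U, v₀ ᵥ* (↑s : Matrix (Fin 4) (Fin 4) F) = v₀ ∧
          ∃ κ ∈ U, (↑κ : Matrix (Fin 4) (Fin 4) F) ∈ K ∧ h = s * κ := by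
  classical
  haveI := locallyCompactSpace_GL_four (F := F)
  haveI := sigmaCompactSpace_GL_four (F := F)
  haveI : LocallyCompactSpace U := hU.locallyCompactSpace
  haveI : SigmaCompactSpace U := hU.sigmaCompactSpace
  haveI : LocallyCompactSpace S := hS.locallyCompactSpace
  -- the right action of `U` on `S`
  have hmem : ∀ (x : S) (g : U), (x : Fin 4 → F) ᵥ* (↑(g : GL (Fin 4) F) : Matrix (Fin 4) (Fin 4) F) ∈ S := by
    intro x g
    obtain ⟨g₀, hg₀, hx⟩ := htrans x x.2
    rw [← hx, vecMul_vecMul, ← Units.val_mul]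
    exact horb _ (U.mul_mem hg₀ g.2)
  let ψ : S → U → S := fun x g => ⟨(x : Fin 4 → F) ᵥ* (↑(g : GL (Fin 4) F) : Matrix (Fin 4) (Fin 4) F), hmem x g⟩
  have hψ1 : ∀ x, ψ x 1 = x := by
    intro x
    apply Subtype.ext
    simp [ψ]
  have hψm : ∀ x g κ, ψ (ψ x g) κ = ψ x (g * κ) := by
    intro x g κ
    apply Subtype.ext
    simp [ψ, vecMul_vecMul]
  let x₀ : S := ⟨v₀, by simpa using horb 1 U.one_mem⟩
  -- the left action `g • x = x g⁻¹`, continuous and transitive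
  letI : MulAction U S :=
    { smul := fun g x => ψ x g⁻¹
      one_smul := fun x => by
        show ψ x 1⁻¹ = x
        rw [inv_one]
        exact hψ1 x
      mul_smul := fun g h x => by
        show ψ x (g * h)⁻¹ = ψ (ψ x h⁻¹) g⁻¹
        rw [hψm, _root_.mul_inv_rev] }
  have hsmul : ∀ (g : U) (x : S), g • x = ψ x g⁻¹ := fun g x => rfl
  haveI : ContinuousSMul U S := by
    refine ⟨?_⟩
    refine Continuous.subtype_mk ?_ _
    exact (continuous_subtype_val.comp continuous_snd).matrix_vecMul
      (Units.continuous_coe_inv.comp (continuous_subtype_val.comp continuous_fst))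
  haveI : MulAction.IsPretransitive U S := by
    refine ⟨fun x y => ?_⟩
    obtain ⟨g₁, hg₁, hx⟩ := htrans x x.2
    obtain ⟨g₂, hg₂, hy⟩ := htrans y y.2
    refine ⟨⟨g₂, hg₂⟩⁻¹ * ⟨g₁, hg₁⟩, ?_⟩
    rw [hsmul]
    apply Subtype.ext
    show (x : Fin 4 → F) ᵥ* (↑(↑((⟨g₂, hg₂⟩ : U)⁻¹ * ⟨g₁, hg₁⟩)⁻¹ : GL (Fin 4) F) : Matrix (Fin 4) (Fin 4) F) = y
    rw [_root_.mul_inv_rev, inv_inv, Subgroup.coe_mul, Subgroup.coe_inv, Units.val_mul, ← vecMul_vecMul, ← hx]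
    simp only [vecMul_vecMul, Units.mul_inv, Matrix.one_mul, hy]
  -- the orbit map `g ↦ v₀ g = g⁻¹ • x₀` is open
  have hφ : IsOpenMap (fun g : U => ψ x₀ g) := by
    have h1 : IsOpenMap (fun g : U => g • x₀) := isOpenMap_smul_of_sigmaCompact x₀
    have h2 : (fun g : U => ψ x₀ g) = (fun g : U => g • x₀) ∘ (fun g : U => g⁻¹) := by
      funext g
      simp only [Function.comp, hsmul, inv_inv]
    rw [h2]
    exact h1.comp (Homeomorph.inv U).isOpenMap
  -- the compact `C ∩ S` inside `S`
  have hC' : IsCompact {x : S | (x : Fin 4 → F) ∈ C} := by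
    rw [Subtype.isCompact_iff]
    have : Subtype.val '' {x : S | (x : Fin 4 → F) ∈ C} = C ∩ S := by
      ext y
      constructor
      · rintro ⟨x, hx, rfl⟩
        exact ⟨hx, x.2⟩
      · rintro ⟨hyC, hyS⟩
        exact ⟨⟨y, hyS⟩, hyC, rfl⟩
    rw [this]
    exact hC.inter_right hS
  have hCr : {x : S | (x : Fin 4 → F) ∈ C} ⊆ Set.range (fun g : U => ψ x₀ g) := by
    intro x _
    obtain ⟨g, hg, hx⟩ := htrans x x.2
    exact ⟨⟨g, hg⟩, Subtype.ext hx⟩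
  obtain ⟨K', hK', hlift⟩ := exists_compact_stab_mul_of_isOpenMap_right ψ hψ1 hψm x₀ hφ hC' hCr
  refine ⟨(fun g : U => (↑(g : GL (Fin 4) F) : Matrix (Fin 4) (Fin 4) F)) '' K',
    hK'.image (Units.continuous_val.comp continuous_subtype_val), ?_⟩
  intro h hh hhC
  obtain ⟨s, hs, κ, hκK, hκ⟩ := hlift ⟨h, hh⟩ hhC
  refine ⟨s, s.2, ?_, κ, κ.2, ⟨κ, hκK, rfl⟩, ?_⟩
  · exact congrArg Subtype.val hs
  · exact congrArg Subtype.val hκ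

end Generic

section Unitary

variable {F : Type*} [Field F] [TopologicalSpace F] [IsTopologicalRing F] [T2Space F]

omit [TopologicalSpace F] [IsTopologicalRing F] [T2Space F] in
/-- The inverse of a `(Bf, Ωf)`-unitary element of `GL₄(F)` is `(Bf, Ωf)`-unitary (typer-2's argument for
`unitaryGroup`, over any field). -/
theorem inv_mem_unitary {Bf Ωf : Matrix (Fin 4) (Fin 4) F} {g : GL (Fin 4) F}
    (h1 : (↑g : Matrix (Fin 4) (Fin 4) F) * Ωf = Ωf * (↑g : Matrix (Fin 4) (Fin 4) F))
    (h2 : (↑g : Matrix (Fin 4) (Fin 4) F) * Bf * (↑g : Matrix (Fin 4) (Fin 4) F)ᵀ = Bf) :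
    (↑(g⁻¹) : Matrix (Fin 4) (Fin 4) F) * Ωf = Ωf * (↑(g⁻¹) : Matrix (Fin 4) (Fin 4) F) ∧
      (↑(g⁻¹) : Matrix (Fin 4) (Fin 4) F) * Bf * (↑(g⁻¹) : Matrix (Fin 4) (Fin 4) F)ᵀ = Bf := by
  have hinv1 : (↑(g⁻¹) : Matrix (Fin 4) (Fin 4) F) * (↑g : Matrix (Fin 4) (Fin 4) F) = 1 := Units.inv_mul g
  have hinv2 : (↑g : Matrix (Fin 4) (Fin 4) F) * (↑(g⁻¹) : Matrix (Fin 4) (Fin 4) F) = 1 := Units.mul_inv g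
  have hinv3 : (↑g : Matrix (Fin 4) (Fin 4) F)ᵀ * (↑(g⁻¹) : Matrix (Fin 4) (Fin 4) F)ᵀ = 1 := by
    rw [← Matrix.transpose_mul, hinv1, Matrix.transpose_one]
  refine ⟨?_, ?_⟩
  · calc (↑(g⁻¹) : Matrix (Fin 4) (Fin 4) F) * Ωf
        = (↑(g⁻¹) : Matrix (Fin 4) (Fin 4) F) * Ωf *
            ((↑g : Matrix (Fin 4) (Fin 4) F) * (↑(g⁻¹) : Matrix (Fin 4) (Fin 4) F)) := by
          rw [hinv2, Matrix.mul_one]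
      _ = (↑(g⁻¹) : Matrix (Fin 4) (Fin 4) F) * ((↑g : Matrix (Fin 4) (Fin 4) F) * Ωf) *
            (↑(g⁻¹) : Matrix (Fin 4) (Fin 4) F) := by
          rw [h1]; simp only [Matrix.mul_assoc]
      _ = Ωf * (↑(g⁻¹) : Matrix (Fin 4) (Fin 4) F) := by rw [← Matrix.mul_assoc, hinv1, Matrix.one_mul]
  · calc (↑(g⁻¹) : Matrix (Fin 4) (Fin 4) F) * Bf * (↑(g⁻¹) : Matrix (Fin 4) (Fin 4) F)ᵀ
        = (↑(g⁻¹) : Matrix (Fin 4) (Fin 4) F) * ((↑g : Matrix (Fin 4) (Fin 4) F) * Bf *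
            (↑g : Matrix (Fin 4) (Fin 4) F)ᵀ) * (↑(g⁻¹) : Matrix (Fin 4) (Fin 4) F)ᵀ := by rw [h2]
      _ = ((↑(g⁻¹) : Matrix (Fin 4) (Fin 4) F) * ↑g) * Bf *
            ((↑g : Matrix (Fin 4) (Fin 4) F)ᵀ * (↑(g⁻¹) : Matrix (Fin 4) (Fin 4) F)ᵀ) := by
          simp only [Matrix.mul_assoc]
      _ = Bf := by rw [hinv1, hinv3, Matrix.one_mul, Matrix.mul_one]

omit [TopologicalSpace F] [IsTopologicalRing F] [T2Space F] in
/-- A `(Bf, Ωf)`-unitary matrix is invertible when `Bf` is: `det h ^ 2 · det Bf = det Bf`. -/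
theorem isUnit_of_unitary {Bf : Matrix (Fin 4) (Fin 4) F} (hB : IsUnit Bf) {h : Matrix (Fin 4) (Fin 4) F}
    (h2 : h * Bf * hᵀ = Bf) : IsUnit h := by
  have hdet : h.det * Bf.det * h.det = Bf.det := by
    have := congrArg Matrix.det h2
    rwa [Matrix.det_mul, Matrix.det_mul, Matrix.det_transpose] at this
  have hBdet : Bf.det ≠ 0 := ((Matrix.isUnit_iff_isUnit_det Bf).mp hB).ne_zero
  refine (Matrix.isUnit_iff_isUnit_det h).mpr (isUnit_iff_ne_zero.mpr ?_)
  intro h0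
  rw [h0, zero_mul, zero_mul] at hdet
  exact hBdet hdet.symm

omit [TopologicalSpace F] [IsTopologicalRing F] [T2Space F] in
/-- The orbit of `v₀` under the `(Bf, Ωf)`-unitary matrices lies on the sphere of `v₀`: the two `F`-coordinates
`x Bf xᵀ` and `(x Ωf) Bf xᵀ` of the hermitian norm are preserved. -/
theorem vecMul_mem_sphere {Bf Ωf : Matrix (Fin 4) (Fin 4) F} {g : Matrix (Fin 4) (Fin 4) F}
    (h1 : g * Ωf = Ωf * g) (h2 : g * Bf * gᵀ = Bf) (v₀ : Fin 4 → F) :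
    (v₀ ᵥ* g) ᵥ* Bf ⬝ᵥ (v₀ ᵥ* g) = v₀ ᵥ* Bf ⬝ᵥ v₀ ∧
      ((v₀ ᵥ* g) ᵥ* Ωf) ᵥ* Bf ⬝ᵥ (v₀ ᵥ* g) = (v₀ ᵥ* Ωf) ᵥ* Bf ⬝ᵥ v₀ := by
  have hT : v₀ ᵥ* g = gᵀ *ᵥ v₀ := (mulVec_transpose g v₀).symm
  constructor
  · calc (v₀ ᵥ* g) ᵥ* Bf ⬝ᵥ (v₀ ᵥ* g) = (v₀ ᵥ* g ᵥ* Bf) ⬝ᵥ (gᵀ *ᵥ v₀) := by rw [← hT]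
      _ = (v₀ ᵥ* (g * Bf * gᵀ)) ⬝ᵥ v₀ := by
          rw [dotProduct_mulVec, vecMul_vecMul, vecMul_vecMul]
          simp only [Matrix.mul_assoc]
      _ = v₀ ᵥ* Bf ⬝ᵥ v₀ := by rw [h2]
  · have h3 : g * Ωf * Bf * gᵀ = Ωf * Bf := by
      rw [h1, Matrix.mul_assoc, Matrix.mul_assoc, ← Matrix.mul_assoc g, h2]
    calc ((v₀ ᵥ* g) ᵥ* Ωf) ᵥ* Bf ⬝ᵥ (v₀ ᵥ* g) = (v₀ ᵥ* g ᵥ* Ωf ᵥ* Bf) ⬝ᵥ (gᵀ *ᵥ v₀) := by rw [← hT]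
      _ = (v₀ ᵥ* (g * Ωf * Bf * gᵀ)) ⬝ᵥ v₀ := by
          rw [dotProduct_mulVec, vecMul_vecMul, vecMul_vecMul, vecMul_vecMul]
          simp only [Matrix.mul_assoc]
      _ = (v₀ ᵥ* Ωf) ᵥ* Bf ⬝ᵥ v₀ := by rw [h3, ← vecMul_vecMul]

/-- **C7.1 / C7.1∞ ⇐ LOCAL WITT.**  `F` a locally compact σ-compact Hausdorff topological field, `Bf` invertible,
`v₀ ∈ F⁴`, and the `(Bf, Ωf)`-unitary matrices TRANSITIVE on the sphere of `v₀` (`htrans`: every `x` with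
`x Bf xᵀ = v₀ Bf v₀ᵀ` and `(x Ωf) Bf xᵀ = (v₀ Ωf) Bf v₀ᵀ` is `v₀ h` for a unitary `h`).  Then for every compact `C ⊆ F⁴`
there is a compact set `K` of matrices such that every unitary `h` with `v₀ h ∈ C` is `s * κ` with `s` unitary fixing
`v₀` and `κ` unitary in `K` — p4's `exists_compact_local_stab_mul_fin` / `…_inf` (C7 census S12903) with
`localU W v` / `localUInf W w` unfolded, `Bf = B.map (algebraMap k F)`, `Ωf = Ω.map (algebraMap k F)`,
`v₀ = finRat v v₀` / `infRat w v₀`. -/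
theorem exists_compact_stab_mul_of_transitive [LocallyCompactSpace F] [SigmaCompactSpace F]
    (Bf Ωf : Matrix (Fin 4) (Fin 4) F) (hB : IsUnit Bf) (v₀ : Fin 4 → F)
    (htrans : ∀ x : Fin 4 → F, x ᵥ* Bf ⬝ᵥ x = v₀ ᵥ* Bf ⬝ᵥ v₀ →
      (x ᵥ* Ωf) ᵥ* Bf ⬝ᵥ x = (v₀ ᵥ* Ωf) ᵥ* Bf ⬝ᵥ v₀ →
      ∃ h : Matrix (Fin 4) (Fin 4) F, (h * Ωf = Ωf * h ∧ h * Bf * hᵀ = Bf) ∧ v₀ ᵥ* h = x)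
    {C : Set (Fin 4 → F)} (hC : IsCompact C) :
    ∃ K : Set (Matrix (Fin 4) (Fin 4) F), IsCompact K ∧
      ∀ h : Matrix (Fin 4) (Fin 4) F, (h * Ωf = Ωf * h ∧ h * Bf * hᵀ = Bf) → v₀ ᵥ* h ∈ C →
        ∃ s : Matrix (Fin 4) (Fin 4) F, (s * Ωf = Ωf * s ∧ s * Bf * sᵀ = Bf) ∧ v₀ ᵥ* s = v₀ ∧
          ∃ κ : Matrix (Fin 4) (Fin 4) F, (κ * Ωf = Ωf * κ ∧ κ * Bf * κᵀ = Bf) ∧ κ ∈ K ∧ h = s * κ := by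
  classical
  -- the unitary subgroup of `GL₄(F)`
  let U : Subgroup (GL (Fin 4) F) :=
    { carrier := {g | (↑g : Matrix (Fin 4) (Fin 4) F) * Ωf = Ωf * (↑g : Matrix (Fin 4) (Fin 4) F) ∧
        (↑g : Matrix (Fin 4) (Fin 4) F) * Bf * (↑g : Matrix (Fin 4) (Fin 4) F)ᵀ = Bf}
      one_mem' := by simp
      mul_mem' := by
        rintro g h ⟨hg1, hg2⟩ ⟨hh1, hh2⟩
        refine ⟨?_, ?_⟩
        · simp only [Units.val_mul]
          rw [Matrix.mul_assoc, hh1, ← Matrix.mul_assoc, hg1, Matrix.mul_assoc]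
        · simp only [Units.val_mul, Matrix.transpose_mul]
          calc (↑g : Matrix (Fin 4) (Fin 4) F) * ↑h * Bf * ((↑h : Matrix (Fin 4) (Fin 4) F)ᵀ *
                (↑g : Matrix (Fin 4) (Fin 4) F)ᵀ)
              = (↑g : Matrix (Fin 4) (Fin 4) F) * ((↑h : Matrix (Fin 4) (Fin 4) F) * Bf *
                  (↑h : Matrix (Fin 4) (Fin 4) F)ᵀ) * (↑g : Matrix (Fin 4) (Fin 4) F)ᵀ := by
                simp only [Matrix.mul_assoc]
            _ = Bf := by rw [hh2, hg2]
      inv_mem' := fun hg => inv_mem_unitary hg.1 hg.2 }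
  have hUmem : ∀ g : GL (Fin 4) F, g ∈ U ↔
      (↑g : Matrix (Fin 4) (Fin 4) F) * Ωf = Ωf * (↑g : Matrix (Fin 4) (Fin 4) F) ∧
      (↑g : Matrix (Fin 4) (Fin 4) F) * Bf * (↑g : Matrix (Fin 4) (Fin 4) F)ᵀ = Bf := fun g => Iff.rfl
  have hU : IsClosed (U : Set (GL (Fin 4) F)) := by
    have e1 : IsClosed {g : GL (Fin 4) F |
        (↑g : Matrix (Fin 4) (Fin 4) F) * Ωf = Ωf * (↑g : Matrix (Fin 4) (Fin 4) F)} :=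
      isClosed_eq (Units.continuous_val.mul continuous_const) (continuous_const.mul Units.continuous_val)
    have e2 : IsClosed {g : GL (Fin 4) F |
        (↑g : Matrix (Fin 4) (Fin 4) F) * Bf * (↑g : Matrix (Fin 4) (Fin 4) F)ᵀ = Bf} :=
      isClosed_eq ((Units.continuous_val.mul continuous_const).mul Units.continuous_val.matrix_transpose)
        continuous_const
    exact e1.inter e2
  -- the sphere
  let S : Set (Fin 4 → F) := {x | x ᵥ* Bf ⬝ᵥ x = v₀ ᵥ* Bf ⬝ᵥ v₀ ∧
    (x ᵥ* Ωf) ᵥ* Bf ⬝ᵥ x = (v₀ ᵥ* Ωf) ᵥ* Bf ⬝ᵥ v₀}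
  have hS : IsClosed S := by
    have e1 : IsClosed {x : Fin 4 → F | x ᵥ* Bf ⬝ᵥ x = v₀ ᵥ* Bf ⬝ᵥ v₀} :=
      isClosed_eq ((continuous_id.matrix_vecMul continuous_const).dotProduct continuous_id)
        continuous_const
    have e2 : IsClosed {x : Fin 4 → F | (x ᵥ* Ωf) ᵥ* Bf ⬝ᵥ x = (v₀ ᵥ* Ωf) ᵥ* Bf ⬝ᵥ v₀} :=
      isClosed_eq (((continuous_id.matrix_vecMul continuous_const).matrix_vecMul
        continuous_const).dotProduct continuous_id) continuous_const
    exact e1.inter e2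
  have horb : ∀ g ∈ U, v₀ ᵥ* (↑g : Matrix (Fin 4) (Fin 4) F) ∈ S := fun g hg =>
    vecMul_mem_sphere hg.1 hg.2 v₀
  have htrans' : ∀ x ∈ S, ∃ g ∈ U, v₀ ᵥ* (↑g : Matrix (Fin 4) (Fin 4) F) = x := by
    intro x hx
    obtain ⟨h, ⟨h1, h2⟩, hh⟩ := htrans x hx.1 hx.2
    have hu : IsUnit h := isUnit_of_unitary hB h2
    refine ⟨hu.unit, ?_, ?_⟩
    · rw [hUmem, hu.unit_spec]
      exact ⟨h1, h2⟩
    · rw [hu.unit_spec]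
      exact hh
  obtain ⟨K, hK, hfib⟩ := exists_compact_stab_mul_of_closed_subgroup U hU v₀ S hS horb htrans' hC
  refine ⟨K, hK, ?_⟩
  intro h ⟨h1, h2⟩ hhC
  have hu : IsUnit h := isUnit_of_unitary hB h2
  have hmem : hu.unit ∈ U := by
    rw [hUmem, hu.unit_spec]
    exact ⟨h1, h2⟩
  obtain ⟨s, hs, hsv, κ, hκ, hκK, hsκ⟩ := hfib hu.unit hmem (by rw [hu.unit_spec]; exact hhC)
  refine ⟨↑s, hs, hsv, ↑κ, hκ, hκK, ?_⟩
  rw [← hu.unit_spec, hsκ, Units.val_mul]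

end Unitary

end Summit.Ventures.HodgeRepro.Tier4.Line1
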